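import Summits.ValiantsHypothesis.ValiantsHypothesis.Theorems.MonotoneRestorationOrbitRestorationQPMatrixAffineTopPair
import Summits.ValiantsHypothesis.ValiantsHypothesis.Theorems.MonotoneRestorationOrbitRestorationQPMatrixAffineTopLarge
import HarnessLib

/-!
# Matrix-symmetric affine products are orbit-restorable (ORBIT currency, ΠΣ sub-rung, rule M2′ assembled)

Route MonotoneRestoration, crux `OrbitRestorationQP` (stmt-ValiantsHypothesis-18293), line `depth-three-rung`,
stub A₁ `stub_piSigmaValue`, namespace `Summit.ValiantsHypothesis.ValiantsHypothesis.Theorems.MatrixAffine`.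

**Theorem** (`qpOrbitRestorable_of_matrixSymmetric`).  Let `n > 8`, `1 ≤ k`, `4k ≤ n`, and let `f = a · Π L ≠ 0` be a
product of fewer than `C(n,k)` polynomials of total degree `1` on the `n × n` matrix that is invariant under the
pure ROW action and under the pure COLUMN action of `Sym(Fin n)` (matrix symmetry).  Then `f` is
`QPOrbitRestorable (2k + 5)` at level `n`: it has a square-symmetric circuit (diagonal action) of orbit size
`≤ 2^((log₂ n + 2k + 5)^(2k+5))`.

This is the `k = 1` (ΠΣ) sub-rung of the first rung of line `depth-three-rung` in value currency, for products of
degree-one forms; the proof is rule M2′ of `Cruxes/OrbitRestorationQP/PISIGMA-SUBRUNG.md`, verified by the parity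
bookkeeping of the evidence note `A1-M2PRIME-PROOF.md` (crux item): keys `R`, `C` or `R ∪ C` according to the parities
of the two fibre sign counts; (MID#)/(TOP#) of `KeyedParity.qpOrbitRestorable_of_keyedBlocks_parity` from FACT 1
(`FibreSigns.rowSupp_eq_pair`), sign multiplicativity on invariant pieces (`PieceSigns.even_diag_piece`), evenness of
the global row/column sign counts (`ActionSignCount.even_card_filter_vact_neg`) and transport of the counts
(`KeyCounts`).  VP ≠ VNP is not moved.

Everything is proved. [folklore]

## References
* A. Dawar, G. Wilsenach, *Symmetric arithmetic circuits*, ToC 21 (2025), §3.3, Def. 6.1. [DawarWilsenach2025]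
* J. D. Dixon, B. Mortimer, *Permutation Groups*, GTM 163 (1996), Thm 5.2B. [DixonMortimer1996]
-/

noncomputable section

open scoped Classical Pointwise

-- `Summit.ValiantsHypothesis.ValiantsHypothesis.…` is the tree's single-conjunct layout (Sub = Summit).
set_option linter.dupNamespace false

namespace Summit.ValiantsHypothesis.ValiantsHypothesis.Theorems

namespace MatrixAffine

open Equiv Finset ProductAction Literature.Computability.AlgebraicComplexity OrbitRestorationQPDepthThreeRung

variable {n : ℕ}

/-- **MATRIX-SYMMETRIC AFFINE PRODUCTS ARE ORBIT-RESTORABLE** (rule M2′).  Let `n > 8`, `1 ≤ k`, `4k ≤ n`, and let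
`f = a · Π L ≠ 0` be a product of fewer than `C(n,k)` polynomials of total degree `1`, invariant under the pure row
action and under the pure column action of `Sym(Fin n)`.  Then `f` is `QPOrbitRestorable (2k + 5)` at level `n`.
[folklore; cite: DawarWilsenach2025, §3.3 and Def. 6.1; DixonMortimer1996, Thm 5.2B] -/
theorem qpOrbitRestorable_of_matrixSymmetric {k : ℕ} (hn : 8 < n) (hk : 1 ≤ k) (h4k : 4 * k ≤ n)
    (L : Multiset (MvPolynomial (Fin n × Fin n) ℂ)) (a : ℂ)
    (hL1 : ∀ ℓ ∈ L, ℓ.totalDegree = 1) (hcard : Multiset.card L < n.choose k)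
    (hf0 : MvPolynomial.C a * L.prod ≠ 0)
    (hrow : ∀ σ : Perm (Fin n), vact (K := ℂ) rowHom σ (MvPolynomial.C a * L.prod) = MvPolynomial.C a * L.prod)
    (hcol : ∀ τ : Perm (Fin n), vact (K := ℂ) colHom τ (MvPolynomial.C a * L.prod) = MvPolynomial.C a * L.prod) :
    QPOrbitRestorable (2 * k + 5) n (MvPolynomial.C a * L.prod) := by
  have hL : ∀ ℓ ∈ L, ℓ.totalDegree ≤ 1 := fun ℓ hℓ => (hL1 ℓ hℓ).le
  have hfix : ∀ σ : Perm (Fin n), ren σ (MvPolynomial.C a * L.prod) = MvPolynomial.C a * L.prod := fun σ => by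
    rw [ren_eq_row_col, hcol, hrow]
  -- row / column supports with (S3)
  obtain ⟨R, C, R1, C1, R2, RC, C2, CR, R3, C3, RS3, CS3⟩ := RowColSupport.exists_rowColSupports (K := ℂ) n
  have hfac : ∀ ℓ ∈ L, (R ℓ).card < k ∧ (C ℓ).card < k ∧
      (∀ ρ : Perm (Fin n), (∀ z ∈ R ℓ, ρ z = z) → vact (K := ℂ) rowHom ρ ℓ = ℓ) ∧
      (∀ ρ : Perm (Fin n), (∀ z ∈ C ℓ, ρ z = z) → vact (K := ℂ) colHom ρ ℓ = ℓ) := by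
    intro ℓ hℓ
    obtain ⟨Y, hYk, hY⟩ :=
      LocalFactors.exists_support_of_mem_factors_local isLocal_rowHom hn hk h4k hL hcard hf0 hrow hℓ
    obtain ⟨Z, hZk, hZ⟩ :=
      LocalFactors.exists_support_of_mem_factors_local isLocal_colHom hn hk h4k hL hcard hf0 hcol hℓ
    obtain ⟨hRY, hRfix⟩ := RS3 ℓ Y (by omega) hY
    obtain ⟨hCZ, hCfix⟩ := CS3 ℓ Z (by omega) hZ
    exact ⟨lt_of_le_of_lt hRY hYk, lt_of_le_of_lt hCZ hZk, hRfix, hCfix⟩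
  have hRfix : ∀ ℓ ∈ L, ∀ ρ : Perm (Fin n), (∀ z ∈ R ℓ, ρ z = z) → vact (K := ℂ) rowHom ρ ℓ = ℓ :=
    fun ℓ hℓ => (hfac ℓ hℓ).2.2.1
  have hCfix : ∀ ℓ ∈ L, ∀ ρ : Perm (Fin n), (∀ z ∈ C ℓ, ρ z = z) → vact (K := ℂ) colHom ρ ℓ = ℓ :=
    fun ℓ hℓ => (hfac ℓ hℓ).2.2.2
  have hL0 : ∀ ℓ ∈ L, ℓ ≠ 0 := fun ℓ hℓ => AffineFactors.ne_zero_of_mem hf0 hℓ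
  -- (α)
  have hα_row : ∀ {x y : Fin n}, x ≠ y → ∀ ℓ ∈ L, vact (K := ℂ) rowHom (swap x y) ℓ = -ℓ → R ℓ = {x, y} :=
    fun hxy ℓ hℓ h => FibreSigns.rowSupp_eq_pair R RS3 (by omega) hxy (hL0 ℓ hℓ) (hL ℓ hℓ) h
  have hα_col : ∀ {x y : Fin n}, x ≠ y → ∀ ℓ ∈ L, vact (K := ℂ) colHom (swap x y) ℓ = -ℓ → C ℓ = {x, y} :=
    fun hxy ℓ hℓ h => FibreSigns.colSupp_eq_pair C CS3 (by omega) hxy (hL0 ℓ hℓ) (hL ℓ hℓ) h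
  -- the two counts and their invariance
  let rc : Finset (Fin n) → Finset (Fin n) → ℕ := fun A B => Multiset.card (L.filter fun ℓ =>
    R ℓ = A ∧ C ℓ = B ∧ (A.card = 2 ∧ ∀ x ∈ A, ∀ y ∈ A, x ≠ y → vact (K := ℂ) rowHom (swap x y) ℓ = -ℓ))
  let cc : Finset (Fin n) → Finset (Fin n) → ℕ := fun A B => Multiset.card (L.filter fun ℓ =>
    R ℓ = A ∧ C ℓ = B ∧ (B.card = 2 ∧ ∀ x ∈ B, ∀ y ∈ B, x ≠ y → vact (K := ℂ) colHom (swap x y) ℓ = -ℓ))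
  have hrc_row : ∀ (σ : Perm (Fin n)) (A B : Finset (Fin n)), rc (σ • A) B = rc A B :=
    fun σ A B => KeyCounts.rowCount_row R C R1 C1 R2 CR hL1 hf0 hrow σ A B
  have hrc_col : ∀ (τ : Perm (Fin n)) (A B : Finset (Fin n)), rc A (τ • B) = rc A B :=
    fun τ A B => KeyCounts.rowCount_col R C R1 C1 C2 RC hL1 hf0 hcol τ A B
  have hcc_col : ∀ (τ : Perm (Fin n)) (A B : Finset (Fin n)), cc A (τ • B) = cc A B :=
    fun τ A B => KeyCounts.colCount_col R C R1 C1 C2 RC hL1 hf0 hcol τ A B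
  have hcc_row : ∀ (σ : Perm (Fin n)) (A B : Finset (Fin n)), cc (σ • A) B = cc A B :=
    fun σ A B => KeyCounts.colCount_row R C R1 C1 R2 CR hL1 hf0 hrow σ A B
  have hrc_ren : ∀ (σ : Perm (Fin n)) (A B : Finset (Fin n)), rc (σ • A) (σ • B) = rc A B :=
    fun σ A B => by rw [hrc_col, hrc_row]
  have hcc_ren : ∀ (σ : Perm (Fin n)) (A B : Finset (Fin n)), cc (σ • A) (σ • B) = cc A B :=
    fun σ A B => by rw [hcc_col, hcc_row]
  -- swapping the two arguments of a count between two-element sets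
  have hswap_counts : ∀ (A B : Finset (Fin n)), A.card = 2 → B.card = 2 → rc B A = rc A B ∧ cc B A = cc A B := by
    intro A B hA hB
    obtain ⟨σ, hσ⟩ := SupportBlocks.exists_perm_smul_eq (hA.trans hB.symm)
    constructor
    · rw [← hσ, hrc_row, hrc_col]
    · rw [← hσ, hcc_row, hcc_col]
  -- degenerate counts
  have hrc_zero : ∀ (A B : Finset (Fin n)), A.card ≠ 2 → rc A B = 0 := by
    intro A B hA
    show Multiset.card _ = 0
    rw [Multiset.card_eq_zero, Multiset.filter_eq_nil]
    rintro ℓ - ⟨-, -, h2, -⟩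
    exact hA h2
  have hcc_zero : ∀ (A B : Finset (Fin n)), B.card ≠ 2 → cc A B = 0 := by
    intro A B hB
    show Multiset.card _ = 0
    rw [Multiset.card_eq_zero, Multiset.filter_eq_nil]
    rintro ℓ - ⟨-, -, h2, -⟩
    exact hB h2
  -- the key
  let kf : Finset (Fin n) → Finset (Fin n) → Finset (Fin n) := fun A B =>
    if Odd (rc A B) ∧ ¬Odd (cc A B) then A else if Odd (cc A B) ∧ ¬Odd (rc A B) then B else A ∪ B
  have hkf_ren : ∀ (σ : Perm (Fin n)) (A B : Finset (Fin n)), kf (σ • A) (σ • B) = σ • kf A B := by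
    intro σ A B
    simp only [kf, hrc_ren, hcc_ren]
    split_ifs <;> simp [Finset.smul_finset_union]
  have hkf_sub : ∀ (A B : Finset (Fin n)), kf A B ⊆ A ∪ B := by
    intro A B
    simp only [kf]
    split_ifs
    · exact subset_union_left
    · exact subset_union_right
    · exact Subset.rfl
  have hkf_cases : ∀ (A B : Finset (Fin n)), (kf A B = A ∧ Odd (rc A B) ∧ ¬Odd (cc A B)) ∨
      (kf A B = B ∧ Odd (cc A B) ∧ ¬Odd (rc A B)) ∨
      (kf A B = A ∪ B ∧ (Odd (rc A B) ↔ Odd (cc A B))) := by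
    intro A B
    simp only [kf]
    split_ifs with h1 h2
    · exact Or.inl ⟨rfl, h1⟩
    · exact Or.inr (Or.inl ⟨rfl, h2⟩)
    · refine Or.inr (Or.inr ⟨rfl, ?_⟩)
      tauto
  let supp : MvPolynomial (Fin n × Fin n) ℂ → Finset (Fin n) := fun q => R q ∪ C q
  let key : MvPolynomial (Fin n × Fin n) ℂ → Finset (Fin n) := fun q => kf (R q) (C q)
  have S1 : ∀ (q : MvPolynomial (Fin n × Fin n) ℂ) (u : ℂ), u ≠ 0 → supp (MvPolynomial.C u * q) = supp q :=
    fun q u hu => by simp only [supp, R1 q u hu, C1 q u hu]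
  have S2 : ∀ (q : MvPolynomial (Fin n × Fin n) ℂ) (σ : Perm (Fin n)), supp (ren σ q) = σ • supp q :=
    fun q σ => by simp only [supp, R3, C3, Finset.smul_finset_union]
  have K1 : ∀ (q : MvPolynomial (Fin n × Fin n) ℂ) (u : ℂ), u ≠ 0 → key (MvPolynomial.C u * q) = key q :=
    fun q u hu => by simp only [key, R1 q u hu, C1 q u hu]
  have K2 : ∀ (q : MvPolynomial (Fin n × Fin n) ℂ) (σ : Perm (Fin n)), key (ren σ q) = σ • key q :=
    fun q σ => by simp only [key, R3, C3, hkf_ren]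
  have S3 : ∀ ℓ ∈ L, ∀ τ : Perm (Fin n), (∀ z ∈ supp ℓ, τ z = z) → ren τ ℓ = ℓ := by
    intro ℓ hℓ τ hτ
    rw [ren_eq_row_col, hCfix ℓ hℓ τ fun z hz => hτ z (Finset.mem_union_right _ hz),
      hRfix ℓ hℓ τ fun z hz => hτ z (Finset.mem_union_left _ hz)]
  have S4 : ∀ ℓ ∈ L, (supp ℓ).card ≤ 2 * k := by
    intro ℓ hℓ
    have := Finset.card_union_le (R ℓ) (C ℓ)
    have h1 := (hfac ℓ hℓ).1
    have h2 := (hfac ℓ hℓ).2.1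
    show (R ℓ ∪ C ℓ).card ≤ 2 * k
    omega
  have K3 : ∀ ℓ ∈ L, key ℓ ⊆ supp ℓ := fun ℓ _ => hkf_sub (R ℓ) (C ℓ)
  refine KeyedParity.qpOrbitRestorable_of_keyedBlocks_parity L a supp key S1 S2 K1 K2 S3 S4 K3 hL1 hf0 hfix ?_ ?_
  · -- (MID#)
    intro K T x hx y hy
    by_cases hxy : x = y
    · subst hxy; rw [filter_ren_swap_self_eq_zero hf0]; exact ⟨0, rfl⟩
    obtain ⟨hxT, hxK⟩ := Finset.mem_sdiff.1 hx
    obtain ⟨hyT, hyK⟩ := Finset.mem_sdiff.1 hy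
    refine even_card_of_fibres (fun ℓ => (R ℓ, C ℓ)) _ fun b => ?_
    obtain ⟨A, B⟩ := b
    set M := ((L.filter fun ℓ => key ℓ = K ∧ supp ℓ = T).filter fun ℓ => ren (swap x y) ℓ = -ℓ).filter
      fun ℓ => (R ℓ, C ℓ) = (A, B) with hM
    show Even (Multiset.card M)
    by_cases hM0 : M = 0
    · rw [hM0]; simp
    obtain ⟨ℓ₀, hℓ₀⟩ := Multiset.exists_mem_of_ne_zero hM0
    have hmemM : ∀ ℓ, ℓ ∈ M ↔ ℓ ∈ L ∧ (kf (R ℓ) (C ℓ) = K ∧ R ℓ ∪ C ℓ = T) ∧ ren (swap x y) ℓ = -ℓ ∧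
        R ℓ = A ∧ C ℓ = B := by
      intro ℓ; simp only [hM, Multiset.mem_filter, Prod.mk.injEq, key, supp]; tauto
    obtain ⟨hℓ₀L, ⟨hk₀, hT₀⟩, hneg₀, hA₀, hB₀⟩ := (hmemM ℓ₀).1 hℓ₀
    rw [hA₀, hB₀] at hk₀ hT₀
    rcases hkf_cases A B with ⟨hkA, hoddr, hevc⟩ | ⟨hkB, hoddc, hevr⟩ | ⟨hkT, -⟩
    · -- R-keyed: `K = A`, `x, y ∉ A`, so the row transposition fixes the fibre and `δ = κ` on it
      rw [hkA] at hk₀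
      subst hk₀
      have hδκ : ∀ ℓ ∈ L, R ℓ = A → (ren (swap x y) ℓ = -ℓ ↔ vact (K := ℂ) colHom (swap x y) ℓ = -ℓ) := by
        intro ℓ hℓ hR
        have hρ : vact (K := ℂ) rowHom (swap x y) ℓ = ℓ := hRfix ℓ hℓ _ fun z hz =>
          swap_apply_of_ne_of_ne (by rintro rfl; exact hxK (hR ▸ hz)) (by rintro rfl; exact hyK (hR ▸ hz))
        rw [ren_eq_row_col, RowColSupport.row_col_comm, hρ]
      have hB : B = {x, y} := by
        rw [← hB₀]; exact hα_col hxy ℓ₀ hℓ₀L ((hδκ ℓ₀ hℓ₀L hA₀).1 hneg₀)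
      subst hB
      have hMeq : M = L.filter fun ℓ => R ℓ = A ∧ C ℓ = {x, y} ∧ (({x, y} : Finset (Fin n)).card = 2 ∧
          ∀ x' ∈ ({x, y} : Finset (Fin n)), ∀ y' ∈ ({x, y} : Finset (Fin n)), x' ≠ y' →
            vact (K := ℂ) colHom (swap x' y') ℓ = -ℓ) := by
        simp only [hM, Multiset.filter_filter]
        refine Multiset.filter_congr fun ℓ hℓ => ?_
        rw [pair_colNeg_iff hxy]
        constructor
        · rintro ⟨hlab, hneg, -, -⟩
          simp only [Prod.mk.injEq] at hlab
          exact ⟨hlab.1, hlab.2, (hδκ ℓ hℓ hlab.1).1 hneg⟩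
        · rintro ⟨hR, hC, hκ⟩
          refine ⟨by simp [hR, hC], (hδκ ℓ hℓ hR).2 hκ, ?_, ?_⟩
          · show kf (R ℓ) (C ℓ) = A
            rw [hR, hC, hkA]
          · show R ℓ ∪ C ℓ = T
            rw [hR, hC, hT₀]
      rw [hMeq]
      exact Nat.not_odd_iff_even.1 hevc
    · -- C-keyed: `K = B`, `x, y ∉ B`, so the column transposition fixes the fibre and `δ = ρ` on it
      rw [hkB] at hk₀
      subst hk₀
      have hδρ : ∀ ℓ ∈ L, C ℓ = B → (ren (swap x y) ℓ = -ℓ ↔ vact (K := ℂ) rowHom (swap x y) ℓ = -ℓ) := by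
        intro ℓ hℓ hC
        have hκ : vact (K := ℂ) colHom (swap x y) ℓ = ℓ := hCfix ℓ hℓ _ fun z hz =>
          swap_apply_of_ne_of_ne (by rintro rfl; exact hxK (hC ▸ hz)) (by rintro rfl; exact hyK (hC ▸ hz))
        rw [ren_eq_row_col, hκ]
      have hA : A = {x, y} := by
        rw [← hA₀]; exact hα_row hxy ℓ₀ hℓ₀L ((hδρ ℓ₀ hℓ₀L hB₀).1 hneg₀)
      subst hA
      have hMeq : M = L.filter fun ℓ => R ℓ = {x, y} ∧ C ℓ = B ∧ (({x, y} : Finset (Fin n)).card = 2 ∧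
          ∀ x' ∈ ({x, y} : Finset (Fin n)), ∀ y' ∈ ({x, y} : Finset (Fin n)), x' ≠ y' →
            vact (K := ℂ) rowHom (swap x' y') ℓ = -ℓ) := by
        simp only [hM, Multiset.filter_filter]
        refine Multiset.filter_congr fun ℓ hℓ => ?_
        rw [pair_rowNeg_iff hxy]
        constructor
        · rintro ⟨hlab, hneg, -, -⟩
          simp only [Prod.mk.injEq] at hlab
          exact ⟨hlab.1, hlab.2, (hδρ ℓ hℓ hlab.2).1 hneg⟩
        · rintro ⟨hR, hC, hρ⟩
          refine ⟨by simp [hR, hC], (hδρ ℓ hℓ hC).2 hρ, ?_, ?_⟩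
          · show kf (R ℓ) (C ℓ) = B
            rw [hR, hC, hkB]
          · show R ℓ ∪ C ℓ = T
            rw [hR, hC, hT₀]
      rw [hMeq]
      exact Nat.not_odd_iff_even.1 hevr
    · -- T-keyed: `K = A ∪ B = T`, contradiction with `x ∈ T \ K`
      rw [hkT] at hk₀
      exact absurd (hk₀ ▸ hT₀ ▸ hxT) hxK
  · -- (TOP#)
    intro K x hx y hy
    by_cases hxy : x = y
    · subst hxy; rw [filter_ren_swap_self_eq_zero hf0]; exact ⟨0, rfl⟩
    have hsK₀ : swap x y • ({x, y} : Finset (Fin n)) = {x, y} :=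
      SignFree.swap_smul_finset_eq (by simp) (by simp)
    -- Step 1: the stable piece
    have hstab : ∀ ℓ ∈ L, ren (swap x y) ℓ = -ℓ → swap x y • R ℓ = R ℓ ∧ swap x y • C ℓ = C ℓ := by
      intro ℓ _ hneg
      have h1 : R (ren (swap x y) ℓ) = R ℓ ∧ C (ren (swap x y) ℓ) = C ℓ := by
        rw [hneg, show (-ℓ : MvPolynomial (Fin n × Fin n) ℂ) = MvPolynomial.C (-1) * ℓ by
          rw [map_neg, map_one]; ring]
        exact ⟨R1 ℓ (-1) (by norm_num), C1 ℓ (-1) (by norm_num)⟩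
      rw [R3, C3] at h1
      exact h1
    let P : MvPolynomial (Fin n × Fin n) ℂ → Prop := fun ℓ =>
      key ℓ = K ∧ swap x y • R ℓ = R ℓ ∧ swap x y • C ℓ = C ℓ
    have hpiece : ((L.filter fun ℓ => key ℓ = K).filter fun ℓ => ren (swap x y) ℓ = -ℓ) =
        ((L.filter P).filter fun ℓ => ren (swap x y) ℓ = -ℓ) := by
      rw [Multiset.filter_filter, Multiset.filter_filter]
      refine Multiset.filter_congr fun ℓ hℓ => ⟨fun h => ⟨h.1, h.2, hstab ℓ hℓ h.1⟩, fun h => ⟨h.1, h.2.1⟩⟩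
    rw [hpiece]
    -- Step 2: sign multiplicativity on the piece
    have hPassoc : ∀ p q : MvPolynomial (Fin n × Fin n) ℂ, Associated p q → (P p ↔ P q) := by
      intro p q hpq
      obtain ⟨c, hc0, rfl⟩ := SupportBlocks.exists_C_of_associated hpq
      simp only [P, key, R1 p c hc0, C1 p c hc0]
    have hinj : ∀ (X Y : Finset (Fin n)), swap x y • X = swap x y • Y → X = Y :=
      fun X Y h => MulAction.injective (swap x y) h
    have hProw : ∀ ℓ, P (vact (K := ℂ) rowHom (swap x y) ℓ) ↔ P ℓ := by
      intro ℓ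
      simp only [P, key, R2, CR]
      by_cases h : swap x y • R ℓ = R ℓ
      · simp [h]
      · constructor
        · rintro ⟨-, h2, -⟩; exact absurd (hinj _ _ h2) h
        · rintro ⟨-, h2, -⟩; exact absurd h2 h
    have hPcol : ∀ ℓ, P (vact (K := ℂ) colHom (swap x y) ℓ) ↔ P ℓ := by
      intro ℓ
      simp only [P, key, RC, C2]
      by_cases h : swap x y • C ℓ = C ℓ
      · simp [h]
      · constructor
        · rintro ⟨-, -, h2⟩; exact absurd (hinj _ _ h2) h
        · rintro ⟨-, -, h2⟩; exact absurd h2 h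
    rw [PieceSigns.even_diag_piece hL1 hf0 hrow hcol P hPassoc hProw hPcol]
    -- Step 3: identify the two counts
    let Qρ : MvPolynomial (Fin n × Fin n) ℂ → Prop := fun ℓ => swap x y • C ℓ = C ℓ ∧ kf {x, y} (C ℓ) = K
    let Qκ : MvPolynomial (Fin n × Fin n) ℂ → Prop := fun ℓ => swap x y • R ℓ = R ℓ ∧ kf (R ℓ) {x, y} = K
    have hXρ : ((L.filter P).filter fun ℓ => vact (K := ℂ) rowHom (swap x y) ℓ = -ℓ) =
        L.filter fun ℓ => vact (K := ℂ) rowHom (swap x y) ℓ = -ℓ ∧ Qρ ℓ := by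
      rw [Multiset.filter_filter]
      refine Multiset.filter_congr fun ℓ hℓ => ?_
      simp only [P, Qρ, key]
      constructor
      · rintro ⟨hneg, hk, -, hC⟩
        have hR := hα_row hxy ℓ hℓ hneg
        rw [hR] at hk
        exact ⟨hneg, hC, hk⟩
      · rintro ⟨hneg, hC, hk⟩
        have hR := hα_row hxy ℓ hℓ hneg
        rw [hR]
        exact ⟨hneg, hk, hsK₀, hC⟩
    have hXκ : ((L.filter P).filter fun ℓ => vact (K := ℂ) colHom (swap x y) ℓ = -ℓ) =
        L.filter fun ℓ => vact (K := ℂ) colHom (swap x y) ℓ = -ℓ ∧ Qκ ℓ := by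
      rw [Multiset.filter_filter]
      refine Multiset.filter_congr fun ℓ hℓ => ?_
      simp only [P, Qκ, key]
      constructor
      · rintro ⟨hneg, hk, hR, -⟩
        have hC := hα_col hxy ℓ hℓ hneg
        rw [hC] at hk
        exact ⟨hneg, hR, hk⟩
      · rintro ⟨hneg, hR, hk⟩
        have hC := hα_col hxy ℓ hℓ hneg
        rw [hC]
        exact ⟨hneg, hk, hR, hsK₀⟩
    rw [hXρ, hXκ]
    -- Step 4: the two cases (separate files)
    by_cases hKK : K = {x, y}
    · subst hKK
      exact top_counts_even_pair R C hL1 hf0 hrow hcol R1 C1 R2 C2 hxy (hα_row hxy) (hα_col hxy) rc cc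
        (fun _ _ => rfl) (fun _ _ => rfl) hswap_counts hrc_zero hcc_zero kf hkf_cases
    · exact top_counts_even_large R C hxy (hα_row hxy) (hα_col hxy) rc cc
        (fun _ _ => rfl) (fun _ _ => rfl) hswap_counts hrc_zero hcc_zero kf hkf_cases hx hy hKK

end MatrixAffine

end Summit.ValiantsHypothesis.ValiantsHypothesis.Theorems

end
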